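import Summits.AnomalousDissipation.AnomalousDissipation.Theses.TaylorCertificates
import Literature.Analysis.FluidPDE.NSHopfExistenceProofs
import Literature.Analysis.FluidPDE.LerayHopfUniformEnergy
import Literature.Analysis.FluidPDE.DoeringFoiasPowerProofs
import Literature.Analysis.FluidPDE.EnergySpaceTorusProofs
import Literature.Analysis.FluidPDE.NSUniqueness2DTruncatedBalance
import Literature.Analysis.FunctionSpaces.TorusTimeAverage
import HarnessLib

/-!
# Route TaylorCertificates — the support `ZeroDatumLerayHopf`

Proof of the route declaration
`Summit.AnomalousDissipation.AnomalousDissipation.Theses.TaylorCertificates.ZeroDatumLerayHopf`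
(item stmt-AnomalousDissipation-13042): for `ν > 0` and a smooth mean-zero force `f` on `T³` there
is a global Leray–Hopf solution `u` from rest (Hopf's theorem, proved in tree:
`hopf_existence_torus_holds.steady`), a lift `U t ∈ H` of its slices (`U t = u t` a.e. for
`t ≥ 0`: every slice is in `L²`, weakly divergence free at every positive time, and has zero mean
by momentum conservation; at `t = 0` the slice vanishes a.e. by the energy inequality), and the
explicit Leray ball `‖U t‖² ≤ 16 ‖f‖₂² / ν²` for all `t ≥ 0`.

The ball: the energy inequalities from `0` and from a.e. `s > 0`, processed by Young and the
Poincaré inequality `|u|² ≤ ‖∇u‖²` on `H` (`IsGlobalLerayHopf.norm_sq_add_dissipation_le`), give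
the restarted integral inequality `y(t) + ν ∫_{(s,t]} y ≤ y(s) + (‖f‖₂²/ν)(t - s)` for the energy
`y = ∫ ‖u‖²`; the tree's `exists_forall_le_of_restart` (`RestartedEnergyBound`) draws a
qualitative bound from it, and `le_of_restart` below is its quantitative form
`y(t) ≤ max (y 0) (4C/a) + 4C/a` (the same discrete Grönwall argument through good times, run
with an arbitrary slack `ε > 0` instead of `1`). From rest `y(0) = 0`, whence
`∫ ‖u(t)‖² ≤ 8 ‖f‖₂²/ν² ≤ 16 ‖f‖₂²/ν²`.

## References

* E. Hopf, Math. Nachr. 4 (1951), 213–231, §§2–4. [Hopf1951]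
* C. Foias, O. Manley, R. Rosa, R. Temam, *Navier–Stokes Equations and Turbulence* (CUP 2001),
  Ch. II App. A (A.38)–(A.42); Ch. IV §3.1 (3.2). [FoiasManleyRosaTemam2001]
* J. C. Robinson, J. L. Rodrigo, W. Sadowski, *The three-dimensional Navier–Stokes equations*
  (CUP 2016), Def. 4.9, Thm. 4.6. [RobinsonRodrigoSadowski2016]
-/

noncomputable section

open MeasureTheory Set Filter Topology UnitAddTorus
open scoped InnerProductSpace RealInnerProductSpace ENNReal NNReal

namespace Summit.AnomalousDissipation.AnomalousDissipation.Theorems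

open Literature.Analysis.FluidPDE Literature.Analysis.FunctionSpaces

-- the mandated namespace `Summit.<Summit>.<Problem>.Theorems` repeats `AnomalousDissipation` (single-problem summit)
set_option linter.dupNamespace false

variable {d : Type*} [Fintype d] [DecidableEq d]

/-! ### A quantitative form of the restarted dissipative bound -/

omit [Fintype d] [DecidableEq d] in
/-- **One restart step with slack `ε`.** If `y ≥ 0` is integrable on `(s, s + h]`, `h = 4/a`,
and `a ∫_{(s, s+h]} y ≤ Y + C h`, then for every `ε > 0` some point `s'` of any full-measure set
`G` of times in `(s + h/2, s + h]` has `y(s') ≤ (Y + Ch)/2 + ε` (the tree's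
`exists_mem_Ioc_le_of_setIntegral_le`, slack `1`, applied to `y/ε`). [folklore] -/
theorem exists_mem_Ioc_le_of_setIntegral_le_eps {y : ℝ → ℝ} {a C Y s ε : ℝ} (ha : 0 < a)
    (hε : 0 < ε) (hy : ∀ t, 0 ≤ y t) (hyi : IntegrableOn y (Ioc s (s + 4 / a)))
    {G : Set ℝ} (hG : ∀ᵐ τ ∂volume, τ ∈ Ioc (s + 2 / a) (s + 4 / a) → τ ∈ G)
    (hint : a * ∫ τ in Ioc s (s + 4 / a), y τ ≤ Y + C * (4 / a)) :
    ∃ s' ∈ G, s + 2 / a ≤ s' ∧ s' ≤ s + 4 / a ∧ y s' ≤ (Y + C * (4 / a)) / 2 + ε := by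
  have hyi' : IntegrableOn (fun τ => y τ / ε) (Ioc s (s + 4 / a)) := Integrable.div_const hyi ε
  have hint' : a * ∫ τ in Ioc s (s + 4 / a), y τ / ε ≤ Y / ε + C / ε * (4 / a) := by
    rw [integral_div, ← mul_div_assoc,
      show Y / ε + C / ε * (4 / a) = (Y + C * (4 / a)) / ε by ring]
    exact div_le_div_of_nonneg_right hint hε.le
  obtain ⟨s', hs'G, h1, h2, h3⟩ := exists_mem_Ioc_le_of_setIntegral_le (y := fun τ => y τ / ε)
    ha (fun t => div_nonneg (hy t) hε.le) hyi' hG hint'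
  refine ⟨s', hs'G, h1, h2, ?_⟩
  have h4 : y s' ≤ ((Y / ε + C / ε * (4 / a)) / 2 + 1) * ε := (div_le_iff₀ hε).1 h3
  have h5 : ((Y / ε + C / ε * (4 / a)) / 2 + 1) * ε = (Y + C * (4 / a)) / 2 + ε := by
    field_simp
  linarith [h4, h5]

omit [Fintype d] [DecidableEq d] in
/-- **Explicit uniform bound from an a.e.-restarted dissipative integral inequality** (the
quantitative form of the tree's `exists_forall_le_of_restart`). Let `y ≥ 0` be integrable on
every `(0, T]`, `a > 0`, `C ≥ 0`, and let `G ⊆ [0, ∞)` contain `0` and almost every positive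
time. If `y(t) + a ∫_{(s,t]} y ≤ y(s) + C (t - s)` for every `s ∈ G` and `t ≥ s`, then
`y(t) ≤ max (y 0) (4C/a) + 4C/a` for every `t ≥ 0`. Proof: the restart step with slack `ε`
produces good times `s_k → ∞` with gaps `≤ 4/a` and `y(s_k) ≤ max (y 0) (4C/a + 2ε)`; between
them `y ≤ y(s_k) + 4C/a`; let `ε → 0` (FMRT 2001, Ch. II (A.41)–(A.42), weak form without the
exponential rate). [folklore] -/
theorem le_of_restart {y : ℝ → ℝ} {a C : ℝ} (ha : 0 < a) (hC : 0 ≤ C)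
    (hy : ∀ t, 0 ≤ y t) (hyi : ∀ T, IntegrableOn y (Ioc 0 T))
    {G : Set ℝ} (hG0 : G ⊆ Ici 0) (h0 : (0 : ℝ) ∈ G) (hG : ∀ᵐ s ∂volume, 0 < s → s ∈ G)
    (hyp : ∀ s ∈ G, ∀ t, s ≤ t → y t + a * ∫ τ in Ioc s t, y τ ≤ y s + C * (t - s))
    {t : ℝ} (ht : 0 ≤ t) :
    y t ≤ max (y 0) (C * (4 / a)) + C * (4 / a) := by
  refine le_of_forall_pos_le_add fun ε hε => ?_
  have hδ : 0 < ε / 2 := half_pos hε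
  have h4a : 0 < 4 / a := by positivity
  have h2a : 0 < 2 / a := by positivity
  -- the restart step from a good time, with slack `ε/2`
  have hstep : ∀ s ∈ G, ∃ s' ∈ G, s + 2 / a ≤ s' ∧ s' ≤ s + 4 / a ∧
      y s' ≤ (y s + C * (4 / a)) / 2 + ε / 2 := by
    intro s hs
    have hs0 : 0 ≤ s := hG0 hs
    refine exists_mem_Ioc_le_of_setIntegral_le_eps ha hδ hy ?_ ?_ ?_
    · exact (hyi (s + 4 / a)).mono_set (Ioc_subset_Ioc_left hs0)
    · filter_upwards [hG] with τ hτ hτI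
      exact hτ (by linarith [hτI.1])
    · have h := hyp s hs (s + 4 / a) (by linarith)
      have hnn : 0 ≤ y (s + 4 / a) := hy _
      rw [add_sub_cancel_left] at h
      linarith
  choose! nxt hnxtG hnxt using hstep
  -- the sequence of good times
  set seq : ℕ → ℝ := fun k => nxt^[k] 0 with hseq
  have hseq_succ : ∀ k, seq (k + 1) = nxt (seq k) := fun k => by
    simp only [hseq, Function.iterate_succ_apply']
  have hseqG : ∀ k, seq k ∈ G := by
    intro k
    induction k with
    | zero => simpa [hseq] using h0
    | succ k ih => rw [hseq_succ]; exact hnxtG _ ih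
  have hseq0 : seq 0 = 0 := by simp [hseq]
  have hgap : ∀ k, seq k + 2 / a ≤ seq (k + 1) ∧ seq (k + 1) ≤ seq k + 4 / a := fun k => by
    rw [hseq_succ]
    exact ⟨(hnxt _ (hseqG k)).1, (hnxt _ (hseqG k)).2.1⟩
  -- values at good times stay below `M`
  set M : ℝ := max (y 0) (C * (4 / a) + ε) with hM
  have hval : ∀ k, y (seq k) ≤ M := by
    intro k
    induction k with
    | zero => rw [hseq0]; exact le_max_left _ _
    | succ k ih =>
      rw [hseq_succ]
      refine (hnxt _ (hseqG k)).2.2.trans ?_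
      have hM2 : C * (4 / a) + ε ≤ M := le_max_right _ _
      linarith
  -- the good times tend to infinity
  have hgrow : ∀ k : ℕ, (k : ℝ) * (2 / a) ≤ seq k := by
    intro k
    induction k with
    | zero => simp [hseq0]
    | succ k ih =>
      have := (hgap k).1
      push_cast
      linarith
  -- locate `t` between two consecutive good times
  have hex : ∃ k : ℕ, t < seq (k + 1) := by
    obtain ⟨k, hk⟩ := exists_nat_gt (t / (2 / a))
    refine ⟨k, lt_of_lt_of_le ?_ (hgrow (k + 1))⟩
    rw [div_lt_iff₀ h2a] at hk
    push_cast
    nlinarith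
  classical
  let k₀ := Nat.find hex
  have hk₀ : t < seq (k₀ + 1) := Nat.find_spec hex
  have hle : seq k₀ ≤ t := by
    rcases Nat.eq_zero_or_pos k₀ with hz | hpos
    · rw [hz, hseq0]; exact ht
    · have hmin := Nat.find_min hex (m := k₀ - 1) (Nat.sub_lt hpos one_pos)
      have hk : k₀ - 1 + 1 = k₀ := by omega
      rw [hk] at hmin
      exact le_of_not_gt hmin
  have hmain := hyp (seq k₀) (hseqG k₀) t hle
  have hint : 0 ≤ a * ∫ τ in Ioc (seq k₀) t, y τ :=
    mul_nonneg ha.le (setIntegral_nonneg measurableSet_Ioc fun τ _ => hy τ)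
  have hdt : t - seq k₀ ≤ 4 / a := by linarith [(hgap k₀).2]
  have hMle : M ≤ max (y 0) (C * (4 / a)) + ε :=
    max_le ((le_max_left _ _).trans (le_add_of_nonneg_right hε.le))
      (by linarith [le_max_right (y 0) (C * (4 / a))])
  calc y t ≤ y (seq k₀) + C * (t - seq k₀) := by linarith
    _ ≤ M + C * (4 / a) := add_le_add (hval k₀) (mul_le_mul_of_nonneg_left hdt hC)
    _ ≤ max (y 0) (C * (4 / a)) + C * (4 / a) + ε := by linarith

/-! ### The explicit Leray ball along a lifted Leray–Hopf trajectory -/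

/-- **The trajectory is bounded in `L²` uniformly in time — explicit form of FMRT (3.2)/(A.42)
with `λ₁ = 1`.** For a global Leray–Hopf solution on `T^d` with viscosity `ν > 0`, steady force
`F ∈ L²` and slices lifted to `H`, for every `t ≥ 0`:
`∫ ‖u(t)‖² ≤ max |u₀|² (4|F|²/ν²) + 4|F|²/ν²`. The energy inequalities from `0` and from a.e.
`s > 0` give, after `IsGlobalLerayHopf.norm_sq_add_dissipation_le`, the restarted integral
inequality `y(t) + ν ∫_{(s,t]} y ≤ y(s) + (|F|²/ν)(t - s)` (with `y(0)` read as `|u₀|²`), to which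
`le_of_restart` applies (the tree's `IsGlobalLerayHopf.exists_forall_integral_norm_sq_le` is the
qualitative form; FMRT 2001, Ch. II (A.41)–(A.42), Ch. IV (3.2)). [cite: FoiasManleyRosaTemam2001, Ch. IV §3.1 (3.2)] -/
theorem integral_norm_sq_le_of_isGlobalLerayHopf {ν : ℝ} {F u₀ : UnitAddTorus d → EuclideanSpace ℝ d}
    {u : ℝ → UnitAddTorus d → EuclideanSpace ℝ d} {U : ℝ → Torus.energySpace d} (hν : 0 < ν)
    (hF : MemLp F 2 volume) (hu : Torus.IsGlobalLerayHopf ν (fun _ => F) u₀ u)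
    (hU : ∀ t, 0 ≤ t →
      ((U t : Lp (EuclideanSpace ℝ d) 2 (volume : Measure (UnitAddTorus d))) :
          UnitAddTorus d → EuclideanSpace ℝ d) =ᵐ[volume] u t)
    {t : ℝ} (ht : 0 ≤ t) :
    ∫ x, ‖u t x‖ ^ 2 ≤
      max (2 * Torus.kineticEnergy u₀) ((∫ x, ‖F x‖ ^ 2) / ν * (4 / ν)) +
        (∫ x, ‖F x‖ ^ 2) / ν * (4 / ν) := by
  classical
  set C : ℝ := (∫ x, ‖F x‖ ^ 2) / ν with hC
  have hC0 : 0 ≤ C := div_nonneg (integral_nonneg fun x => sq_nonneg _) hν.le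
  set E₀ : ℝ := 2 * Torus.kineticEnergy u₀ with hE₀
  have hE₀0 : 0 ≤ E₀ := mul_nonneg zero_le_two (Torus.kineticEnergy_nonneg _)
  -- the energy with `y 0` read as `|u₀|²`
  set y : ℝ → ℝ := fun t => if t = 0 then E₀ else ∫ x, ‖u t x‖ ^ 2 with hy
  have hy_of_pos : ∀ t, 0 < t → y t = ∫ x, ‖u t x‖ ^ 2 := fun t ht => by
    simp [hy, ht.ne']
  have hy0 : ∀ t, 0 ≤ y t := fun t => by
    by_cases ht : t = 0
    · simp [hy, ht, hE₀0]
    · simp only [hy, ht, if_false]; exact integral_nonneg fun x => sq_nonneg _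
  have hyI : ∀ s t, 0 ≤ s → ∫ τ in Ioc s t, y τ = ∫ τ in Ioc s t, (∫ x, ‖u τ x‖ ^ 2) :=
    fun s t hs => setIntegral_congr_fun measurableSet_Ioc fun τ hτ => hy_of_pos τ (hs.trans_lt hτ.1)
  have hyi : ∀ T, IntegrableOn y (Ioc 0 T) := by
    intro T
    rcases le_or_gt T 0 with hT | hT
    · rw [Ioc_eq_empty (not_lt.2 hT)]
      exact integrableOn_empty
    · exact (hu.integrableOn_integral_norm_sq hT).congr_fun
        (fun τ hτ => (hy_of_pos τ hτ.1).symm) measurableSet_Ioc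
  -- the good initial times
  set G : Set ℝ := {s | 0 ≤ s ∧ ∀ t, s ≤ t →
    y t + ν * ∫ τ in Ioc s t, y τ ≤ y s + C * (t - s)} with hG
  -- `0 ∈ G`: the energy inequality from `0`
  have h0 : (0 : ℝ) ∈ G := by
    refine ⟨le_rfl, fun t ht => ?_⟩
    rcases eq_or_lt_of_le ht with ht0 | ht0
    · subst ht0
      simp
    · have hE := (hu (t + 1) (by linarith)).energy_ineq_zero t ⟨ht, by linarith⟩
      have h := hu.norm_sq_add_dissipation_le hν hF hU le_rfl ht hE
      have hP := hu.setIntegral_norm_sq_le_toReal_lintegral hU le_rfl ht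
      rw [hyI 0 t le_rfl, hy_of_pos t ht0]
      have hy00 : y 0 = E₀ := by simp [hy]
      rw [hy00]
      nlinarith [hν, h, hP]
  -- a.e. `s > 0` lies in `G`: the energy inequality from a.e. `s`
  have hG' : ∀ᵐ s ∂volume, 0 < s → s ∈ G := by
    have hn : ∀ n : ℕ, ∀ᵐ s ∂volume, s ∈ Ioo (0 : ℝ) (n + 1) → ∀ t ∈ Icc s ((n : ℝ) + 1),
        Torus.kineticEnergy (u t) +
            ν * (∫⁻ τ in Ioo s t, Torus.eGradNormSq (u τ)).toReal ≤
          Torus.kineticEnergy (u s) + ∫ τ in s..t, ∫ x, ⟪F x, u τ x⟫ := fun n =>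
      (ae_restrict_iff' measurableSet_Ioo).1
        (hu ((n : ℝ) + 1) (by positivity)).energy_ineq_ae
    rw [← ae_all_iff] at hn
    filter_upwards [hn] with s hs hs0
    refine ⟨hs0.le, fun t hst => ?_⟩
    obtain ⟨n, hn'⟩ := exists_nat_gt t
    have hE := hs n ⟨hs0, by linarith⟩ t ⟨hst, by linarith⟩
    have h := hu.norm_sq_add_dissipation_le hν hF hU hs0.le hst hE
    have hP := hu.setIntegral_norm_sq_le_toReal_lintegral hU hs0.le hst
    rw [hyI s t hs0.le, hy_of_pos t (hs0.trans_le hst), hy_of_pos s hs0]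
    have hkin : Torus.kineticEnergy (u s) = 2⁻¹ * ∫ x, ‖u s x‖ ^ 2 := rfl
    rw [hkin] at h
    nlinarith [hν, h, hP]
  have hR : ∀ t, 0 ≤ t → y t ≤ max (y 0) (C * (4 / ν)) + C * (4 / ν) := fun t ht =>
    le_of_restart hν hC0 hy0 hyi (fun s hs => hs.1) h0 hG' (fun s hs t hst => hs.2 t hst) ht
  have hy00 : y 0 = E₀ := by simp [hy]
  rcases eq_or_lt_of_le ht with ht0 | ht0
  · -- `t = 0`: `|u(0)|² ≤ |u₀|²` from the energy inequality at `t = 0`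
    subst ht0
    have hE := (hu 1 one_pos).energy_ineq_zero 0 ⟨le_rfl, zero_le_one⟩
    rw [intervalIntegral.integral_same, add_zero] at hE
    have hD : 0 ≤ ν * (∫⁻ τ in Ioo (0 : ℝ) 0, Torus.eGradNormSq (u τ)).toReal :=
      mul_nonneg hν.le ENNReal.toReal_nonneg
    have hkin : Torus.kineticEnergy (u 0) = 2⁻¹ * ∫ x, ‖u 0 x‖ ^ 2 := rfl
    have hkin0 : Torus.kineticEnergy u₀ = 2⁻¹ * E₀ := by
      rw [hE₀]; ring
    rw [hkin, hkin0] at hE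
    have h1 : E₀ ≤ max E₀ (C * (4 / ν)) := le_max_left _ _
    have h2 : 0 ≤ C * (4 / ν) := by positivity
    linarith
  · rw [← hy_of_pos t ht0, ← hy00]
    exact hR t ht

/-! ### The lift of a Leray–Hopf solution from rest to the energy space -/

/-- **From rest the initial slice vanishes**: for a global Leray–Hopf solution on `T^d` with
datum `0` (and any force), `u 0 = 0` a.e. — the energy inequality from `0` at `t = 0` reads
`½ ∫ ‖u(0)‖² ≤ ½ ∫ ‖0‖² = 0`. [folklore] -/
theorem ae_eq_zero_of_isGlobalLerayHopf_zero {ν : ℝ} {f u : ℝ → UnitAddTorus d → EuclideanSpace ℝ d}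
    (hu : Torus.IsGlobalLerayHopf ν f 0 u) : u 0 =ᵐ[volume] 0 := by
  have hE := (hu 1 one_pos).energy_ineq_zero 0 ⟨le_rfl, zero_le_one⟩
  rw [intervalIntegral.integral_same, add_zero, Ioo_self, Measure.restrict_empty,
    lintegral_zero_measure, ENNReal.toReal_zero, mul_zero, add_zero] at hE
  have hkin0 : Torus.kineticEnergy (0 : UnitAddTorus d → EuclideanSpace ℝ d) = 0 := by
    simp [Torus.kineticEnergy]
  have hkin : Torus.kineticEnergy (u 0) = 2⁻¹ * ∫ x, ‖u 0 x‖ ^ 2 := rfl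
  rw [hkin, hkin0] at hE
  have hint : Integrable (fun x => ‖u 0 x‖ ^ 2) volume :=
    (hu.memLp_two le_rfl).integrable_norm_pow two_ne_zero
  have h0 : ∫ x, ‖u 0 x‖ ^ 2 = 0 :=
    le_antisymm (by linarith) (integral_nonneg fun x => sq_nonneg _)
  have hae := (integral_eq_zero_iff_of_nonneg (fun x => sq_nonneg _) hint).1 h0
  filter_upwards [hae] with x hx
  simpa using hx

/-- **Weak divergence-freeness of every slice from rest**: for a global Leray–Hopf solution with
datum `0`, `u t` is weakly divergence free for every `t ≥ 0` (at `t > 0` by weak continuity,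
`Torus.IsLerayHopfOn.isWeaklyDivFree_of_mem_Ioc`; at `t = 0` the slice vanishes a.e.). [folklore] -/
theorem isWeaklyDivFree_slice_of_isGlobalLerayHopf_zero {ν : ℝ}
    {f u : ℝ → UnitAddTorus d → EuclideanSpace ℝ d} (hu : Torus.IsGlobalLerayHopf ν f 0 u)
    {t : ℝ} (ht : 0 ≤ t) :
    Torus.IsWeaklyDivFree (u t) := by
  rcases eq_or_lt_of_le ht with ht0 | ht0
  · subst ht0
    intro θ _
    have h : (fun x => ⟪u 0 x, Torus.gradient θ x⟫) =ᵐ[volume] fun _ => (0 : ℝ) := by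
      filter_upwards [ae_eq_zero_of_isGlobalLerayHopf_zero hu] with x hx
      rw [hx, Pi.zero_apply, inner_zero_left]
    rw [integral_congr_ae h, integral_zero]
  · exact (hu t ht0).isWeaklyDivFree_of_mem_Ioc ⟨ht0, le_rfl⟩

/-- **Zero momentum from rest**: for a global Leray–Hopf solution on `T^d` from rest driven by a
steady smooth mean-zero force, `∫ u(t) = 0` for every `t ≥ 0` (momentum conservation,
`Torus.IsGlobalLerayHopf.integral_inner_const_eq`, at `t > 0`; the slice vanishes a.e. at
`t = 0`). [folklore] -/
theorem integral_slice_eq_zero_of_isGlobalLerayHopf_zero {ν : ℝ}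
    {f : UnitAddTorus d → EuclideanSpace ℝ d} {u : ℝ → UnitAddTorus d → EuclideanSpace ℝ d}
    (hf : Torus.IsSmooth f) (hf0 : Torus.HasZeroMean f)
    (hu : Torus.IsGlobalLerayHopf ν (fun _ => f) 0 u) {t : ℝ} (ht : 0 ≤ t) :
    ∫ x, u t x = 0 := by
  rcases eq_or_lt_of_le ht with ht0 | ht0
  · subst ht0
    rw [integral_congr_ae (ae_eq_zero_of_isGlobalLerayHopf_zero hu)]
    simp
  · have hut : Integrable (u t) volume := (hu.memLp_two ht).integrable one_le_two
    refine ext_inner_left ℝ fun e => ?_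
    rw [← integral_inner hut e, inner_zero_right]
    have h1 := hu.integral_inner_const_eq hf hf0 e ht0
    have h2 : (∫ x, ⟪e, u t x⟫) = ∫ x, ⟪u t x, e⟫ :=
      integral_congr_ae (ae_of_all _ fun x => real_inner_comm _ _)
    rw [h2, h1]
    simp

/-- **The `H`-lift of a Leray–Hopf solution from rest.** For a global Leray–Hopf solution `u` on
`T^d` from rest driven by a steady smooth mean-zero force there is `U : ℝ → H` with
`U t = u t` a.e. for every `t ≥ 0`: the `L²` class of the slice (`IsLerayHopfOn.memLp`) is
weakly divergence free with zero mean, hence lies in `H` by the intrinsic description of the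
energy space (`Torus.mem_energySpace_of_isWeaklyDivFree_of_hasZeroMean`, Constantin–Foias 1988,
Ch. 4 (4.33)). [folklore] -/
theorem exists_energySpace_lift_of_isGlobalLerayHopf_zero {ν : ℝ}
    {f : UnitAddTorus d → EuclideanSpace ℝ d} {u : ℝ → UnitAddTorus d → EuclideanSpace ℝ d}
    (hf : Torus.IsSmooth f) (hf0 : Torus.HasZeroMean f)
    (hu : Torus.IsGlobalLerayHopf ν (fun _ => f) 0 u) :
    ∃ U : ℝ → Torus.energySpace d, ∀ t, 0 ≤ t →
      ((U t : Lp (EuclideanSpace ℝ d) 2 (volume : Measure (UnitAddTorus d))) :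
          UnitAddTorus d → EuclideanSpace ℝ d) =ᵐ[volume] u t := by
  have key : ∀ t, ∃ V : Torus.energySpace d, 0 ≤ t →
      ((V : Lp (EuclideanSpace ℝ d) 2 (volume : Measure (UnitAddTorus d))) :
          UnitAddTorus d → EuclideanSpace ℝ d) =ᵐ[volume] u t := by
    intro t
    by_cases ht : 0 ≤ t
    · have hmem : MemLp (u t) 2 volume := hu.memLp_two ht
      have hV : ((hmem.toLp (u t) : Lp (EuclideanSpace ℝ d) 2 (volume : Measure (UnitAddTorus d))) :
          UnitAddTorus d → EuclideanSpace ℝ d) =ᵐ[volume] u t := hmem.coeFn_toLp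
      have hVmem : hmem.toLp (u t) ∈ Torus.energySpace d := by
        refine Torus.mem_energySpace_of_isWeaklyDivFree_of_hasZeroMean
          ((isWeaklyDivFree_slice_of_isGlobalLerayHopf_zero hu ht).congr_ae hV.symm) ?_
        show ∫ x, ((hmem.toLp (u t) : Lp (EuclideanSpace ℝ d) 2 (volume : Measure (UnitAddTorus d))) :
          UnitAddTorus d → EuclideanSpace ℝ d) x = 0
        rw [integral_congr_ae hV]
        exact integral_slice_eq_zero_of_isGlobalLerayHopf_zero hf hf0 hu ht
      exact ⟨⟨_, hVmem⟩, fun _ => hV⟩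
    · exact ⟨0, fun h => absurd h ht⟩
  choose U hU using key
  exact ⟨U, hU⟩

/-! ### The route declaration -/

/-- **`ZeroDatumLerayHopf` (route TaylorCertificates, item stmt-AnomalousDissipation-13042).** For
`ν > 0` and a smooth mean-zero force `f` on `T³`: a global Leray–Hopf solution `u` from rest
(Hopf 1951; `hopf_existence_torus_holds.steady`, proved in tree — no solenoidality of `f` is
needed), its lift `U t ∈ H` with `U t = u t` a.e. for `t ≥ 0`
(`exists_energySpace_lift_of_isGlobalLerayHopf_zero`), and the explicit Leray ball
`‖U t‖² ≤ 16 ‖f‖₂²/ν²` for all `t ≥ 0` (`integral_norm_sq_le_of_isGlobalLerayHopf` from rest gives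
`8 ‖f‖₂²/ν²`). [cite: Hopf1951, §§2–4] [cite: FoiasManleyRosaTemam2001, Ch. IV §3.1 (3.2)] -/
theorem ZeroDatumLerayHopf_proof :
    Summit.AnomalousDissipation.AnomalousDissipation.Theses.TaylorCertificates.ZeroDatumLerayHopf := by
  intro ν f hν hf hf0
  -- Hopf's theorem from rest
  have hdiv0 : Torus.IsWeaklyDivFree (0 : UnitAddTorus (Fin 3) → EuclideanSpace ℝ (Fin 3)) :=
    fun θ _ => by simp
  obtain ⟨u, hu⟩ := hopf_existence_torus_holds.steady hν hf (u₀ := 0) MemLp.zero hdiv0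
  -- the lift to `H`
  obtain ⟨U, hU⟩ := exists_energySpace_lift_of_isGlobalLerayHopf_zero hf hf0 hu
  refine ⟨u, U, hu, hU, fun t ht => ?_⟩
  -- the Leray ball
  have hball := integral_norm_sq_le_of_isGlobalLerayHopf hν (hf.memLp 2) hu hU ht
  have hkin0 : Torus.kineticEnergy (0 : UnitAddTorus (Fin 3) → EuclideanSpace ℝ (Fin 3)) = 0 := by
    simp [Torus.kineticEnergy]
  have hF0 : 0 ≤ ∫ x, ‖f x‖ ^ 2 := integral_nonneg fun x => sq_nonneg _
  have hC0 : 0 ≤ (∫ x, ‖f x‖ ^ 2) / ν * (4 / ν) := by positivity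
  rw [hkin0, mul_zero, max_eq_right hC0] at hball
  rw [Submodule.coe_norm, ← Torus.integral_norm_sq_eq_norm_lift_sq hU ht]
  have hid : (∫ x, ‖f x‖ ^ 2) / ν * (4 / ν) + (∫ x, ‖f x‖ ^ 2) / ν * (4 / ν) =
      8 * (∫ x, ‖f x‖ ^ 2) / ν ^ 2 := by
    field_simp
    ring
  have h16 : 8 * (∫ x, ‖f x‖ ^ 2) / ν ^ 2 ≤ 16 * (∫ x, ‖f x‖ ^ 2) / ν ^ 2 :=
    div_le_div_of_nonneg_right (by nlinarith) (sq_nonneg ν)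
  linarith

end Summit.AnomalousDissipation.AnomalousDissipation.Theorems
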